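import Summits.RiemannHypothesis.RiemannHypothesis.Theorems.GroundBartaEvenWinsBeyondArchDeflationRN83OWinF
import HarnessLib

/-!
# RiemannHypothesis / GroundBarta — rung 4 (`EvenWinsBeyondArch`): R-layer certificate of cell `RN83O` — projection constants

Generated by `tools/rgen/gen4.py` = prover A g12's four-slot ((2, 3, 4, 5)-window) port of prover B's `tools/rgen/gen.py consts` (prover B / A g12): `ro83Mc` (midpoint of the certified bracket of the window's Markov constant) and
`ro83Wd = diag(ρ̃)` (prover A's Ritz values), the coefficients `W_il = W̃_il + δ_il (M̃ − M_c)` of the sigma criterion.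
-/

set_option linter.dupNamespace false

noncomputable section

open MeasureTheory Set Filter intervalIntegral
open scoped Topology BigOperators

namespace Summit.RiemannHypothesis.RiemannHypothesis.Theorems.EvenWinsBeyondArch

open Literature.NumberTheory.LFunctions
open Literature.Analysis.ValidatedNumerics Literature.Analysis.ValidatedNumerics.PolyMP
  Literature.Analysis.ValidatedNumerics.NumericsMP Literature.Analysis.ValidatedNumerics.ExpPoly
/-- `M̃`: midpoint of the certified bracket of `M_{83/100}` -/
def ro83Mc : ℚ := ((97536819755564870201749 : ℚ)/10000000000000000000000)
/-- `W̃ = diag(ρ̃)` (A's Ritz values) -/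
def ro83Wd : Fin 8 → Fin 8 → ℚ := fun a l ↦ if a = l then (![((11392213 : ℚ)/20000000000000000000000), ((13219107 : ℚ)/100000000000000000), ((10567193 : ℚ)/2000000000000), ((313297 : ℚ)/20000000), ((4481327 : ℚ)/6250000), ((21111727 : ℚ)/25000000), ((662999 : ℚ)/625000), ((13202151 : ℚ)/10000000)] : Fin 8 → ℚ) a else 0

end Summit.RiemannHypothesis.RiemannHypothesis.Theorems.EvenWinsBeyondArch

end
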